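import Mathlib

/-!
# The Marica–Schönheim pencil over a finite field can be SINGULAR: the Fano plane over `ZMod 7`

Helper file for crux `stmt-CriticalPhenomena-4575` (`NoHeavyLowerTail`, route `PercNearOneGluingNoHeavy`),
new-inequality factory seat `prim-ineq-gen-3` (gen 24).  Everything here is PROVED; no definitions.

Notation (memo `run/shared/lean/prim/prim-ineq-gen-3/CONJECTURE-P2.md`): for a finite family `𝒜` with difference family
`D = 𝒜 \\ 𝒜`, the PENCIL rows are `A ↦ (E ↦ [E ⊆ A] + t · [E ∩ A = ∅])`, `E ∈ D`.  Gen 20 proved that they are linearly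
independent over `ℚ` for every rational `t ≠ ±1` (`OrderedDifferences.linearIndependent_pencil_diffs`), and gens 21–23 asked for
the same over EVERY field (`CONJECTURE MS-PENCIL/𝔽`), together with the stronger parameter-free `2-chain periodicity` P2
(`λ Z = μ Y ∧ μ Z = ν Y ⟹ λ = ν`, which implies the pencil statement over the field in question,
`OrderedDifferences.linearIndependent_pencil_of_twoChain`) and its integral forms SQ / CE2 / `(1 - t²)² T_ℤ = 0`.

**All of these are FALSE.**  Take the Fano plane: the seven lines `{0,1,2}, {0,3,4}, {0,5,6}, {1,3,5}, {1,4,6}, {2,3,6}, {2,4,5}`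
of `PG(2,2)` as `3`-subsets of `Fin 7`.  Two lines meet in exactly one point, so `D = {∅} ∪ {all 21 pairs}`; a pair lies on
exactly ONE line and is disjoint from exactly TWO lines, while `∅` lies in and is disjoint from all SEVEN.  Hence over `ZMod 7`

* `fano_sum_subset`, `fano_sum_disjoint` — the column sums `∑_C [A \ B ⊆ C]` and `∑_C [(A \ B) ∩ C = ∅]` are `0, 0` for `A = B`
  and `1, 2` for `A ≠ B`;
* `fano_not_linearIndependent_pencil` — at `t = 3 = -1/2` the SUM OF ALL SEVEN PENCIL ROWS VANISHES (`1 + 3·2 = 7 = 0`,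
  `7 + 3·7 = 0`), although `3 · 3 = 2 ≠ 1`: the pencil rows are linearly dependent over the field `ZMod 7`;
* `fano_not_twoChain` — P2 fails over `ZMod 7`: `(𝟙, 4·𝟙, 2·𝟙)` is a 2-chain (`1·1 = 4·2`, `4·1 = 2·2` in `ZMod 7`) with `𝟙 ≠ 2·𝟙`;
* `exists_pencil_rows_dependent`, `exists_not_twoChain` — the packaged negations of MS-PENCIL/𝔽 and of P2-over-every-field.

The same computation works for the lines of any projective plane `PG(2,q)` over `ZMod p` with `p ∣ q² + q + 1`, `p ≠ 3`
(`t = -1/q`), and for other symmetric designs (e.g. the `(15,7,3)` design over `ZMod 5`, `t = 2`).  In general the cokernel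
`T_ℤ = ℤ[t]^𝒜 / col(Z + tY)` is a finitely generated ABELIAN GROUP on which `t` acts by an integer matrix; the pencil statement
holds over every field of characteristic `p` exactly when `t² - 1` is nilpotent on `T_ℤ / p T_ℤ`, which can fail only for the
finitely many primes dividing the order of the torsion subgroup of `T_ℤ` (Fano: `T_ℤ ≅ ℤ/2 ⊕ ℤ/2 ⊕ ℤ/14`, `t ≡ 3` on `T_ℤ/7`).
What survives: the theorem over `ℚ` (and over `ZMod p` for all `p` not dividing `#T_ℤ,tors`), and — still open — P2 over `ℚ`.
(prim-ineq-gen-3 gen 24, 2026-08-24; memo `FINDINGS-gen24.md`.)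
-/

namespace Summit.CriticalPhenomena.PercolationContinuityZ3.Theorems

namespace OrderedDifferences

open Finset
open scoped FinsetFamily

/-- Column sums of the containment matrix of the Fano plane: for lines `A, B`, the number of lines containing `A \ B` is
`7 ≡ 0` if `A = B` (then `A \ B = ∅`) and `1` otherwise (a pair of points lies on a unique line), in `ZMod 7`. -/
theorem fano_sum_subset (A B : Finset (Fin 7))
    (hA : A ∈ ({{0, 1, 2}, {0, 3, 4}, {0, 5, 6}, {1, 3, 5}, {1, 4, 6}, {2, 3, 6}, {2, 4, 5}} : Finset (Finset (Fin 7))))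
    (hB : B ∈ ({{0, 1, 2}, {0, 3, 4}, {0, 5, 6}, {1, 3, 5}, {1, 4, 6}, {2, 3, 6}, {2, 4, 5}} : Finset (Finset (Fin 7)))) :
    ∑ C ∈ ({{0, 1, 2}, {0, 3, 4}, {0, 5, 6}, {1, 3, 5}, {1, 4, 6}, {2, 3, 6}, {2, 4, 5}} : Finset (Finset (Fin 7))),
      (if A \ B ⊆ C then (1 : ZMod 7) else 0) = if A = B then 0 else 1 := by
  simp only [mem_insert, mem_singleton] at hA hB
  rcases hA with rfl | rfl | rfl | rfl | rfl | rfl | rfl <;>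
  rcases hB with rfl | rfl | rfl | rfl | rfl | rfl | rfl <;>
  decide

/-- Column sums of the disjointness matrix of the Fano plane: for lines `A, B`, the number of lines disjoint from `A \ B` is
`7 ≡ 0` if `A = B` and `2` otherwise (the lines missing both points of a pair), in `ZMod 7`. -/
theorem fano_sum_disjoint (A B : Finset (Fin 7))
    (hA : A ∈ ({{0, 1, 2}, {0, 3, 4}, {0, 5, 6}, {1, 3, 5}, {1, 4, 6}, {2, 3, 6}, {2, 4, 5}} : Finset (Finset (Fin 7))))
    (hB : B ∈ ({{0, 1, 2}, {0, 3, 4}, {0, 5, 6}, {1, 3, 5}, {1, 4, 6}, {2, 3, 6}, {2, 4, 5}} : Finset (Finset (Fin 7)))) :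
    ∑ C ∈ ({{0, 1, 2}, {0, 3, 4}, {0, 5, 6}, {1, 3, 5}, {1, 4, 6}, {2, 3, 6}, {2, 4, 5}} : Finset (Finset (Fin 7))),
      (if Disjoint (A \ B) C then (1 : ZMod 7) else 0) = if A = B then 0 else 2 := by
  simp only [mem_insert, mem_singleton] at hA hB
  rcases hA with rfl | rfl | rfl | rfl | rfl | rfl | rfl <;>
  rcases hB with rfl | rfl | rfl | rfl | rfl | rfl | rfl <;>
  decide

/-- **The Marica–Schönheim pencil is singular over `ZMod 7` at `t = 3` for the Fano plane.**  With `𝒜` the seven lines of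
`PG(2,2)` on `Fin 7`, the pencil rows `A ↦ (E ↦ [E ⊆ A] + 3 · [E ∩ A = ∅])` over `𝒜 \\ 𝒜` are linearly DEPENDENT over
`ZMod 7` (their sum is zero), although `3 · 3 ≠ 1`.  This refutes CONJECTURE MS-PENCIL/𝔽 of gens 20–23 (the statement
`OrderedDifferences.linearIndependent_pencil_diffs` does not extend from `ℚ` to all fields). -/
theorem fano_not_linearIndependent_pencil :
    ¬ LinearIndependent (ZMod 7)
      (fun A : ({{0, 1, 2}, {0, 3, 4}, {0, 5, 6}, {1, 3, 5}, {1, 4, 6}, {2, 3, 6}, {2, 4, 5}} : Finset (Finset (Fin 7))) =>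
        fun E : (({{0, 1, 2}, {0, 3, 4}, {0, 5, 6}, {1, 3, 5}, {1, 4, 6}, {2, 3, 6}, {2, 4, 5}} : Finset (Finset (Fin 7))) \\
            ({{0, 1, 2}, {0, 3, 4}, {0, 5, 6}, {1, 3, 5}, {1, 4, 6}, {2, 3, 6}, {2, 4, 5}} : Finset (Finset (Fin 7))) :
              Finset (Finset (Fin 7))) =>
          (if (E : Finset (Fin 7)) ⊆ (A : Finset (Fin 7)) then (1 : ZMod 7) else 0) +
            3 * (if Disjoint (E : Finset (Fin 7)) (A : Finset (Fin 7)) then (1 : ZMod 7) else 0)) := by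
  rw [Fintype.not_linearIndependent_iff]
  refine ⟨fun _ => 1, ?_, ⟨⟨{0, 1, 2}, by simp⟩, by decide⟩⟩
  funext E
  obtain ⟨E, hE⟩ := E
  obtain ⟨A, hA, B, hB, rfl⟩ := mem_diffs.mp hE
  simp only [Finset.sum_apply, Pi.smul_apply, smul_eq_mul, one_mul, Pi.zero_apply]
  have e : (∑ C : ({{0, 1, 2}, {0, 3, 4}, {0, 5, 6}, {1, 3, 5}, {1, 4, 6}, {2, 3, 6}, {2, 4, 5}} : Finset (Finset (Fin 7))),
      ((if A \ B ⊆ (C : Finset (Fin 7)) then (1 : ZMod 7) else 0) +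
        3 * (if Disjoint (A \ B) (C : Finset (Fin 7)) then (1 : ZMod 7) else 0))) =
      ∑ C ∈ ({{0, 1, 2}, {0, 3, 4}, {0, 5, 6}, {1, 3, 5}, {1, 4, 6}, {2, 3, 6}, {2, 4, 5}} : Finset (Finset (Fin 7))),
        ((if A \ B ⊆ C then (1 : ZMod 7) else 0) + 3 * (if Disjoint (A \ B) C then (1 : ZMod 7) else 0)) :=
    Finset.sum_coe_sort _ (fun C => (if A \ B ⊆ C then (1 : ZMod 7) else 0) +
      3 * (if Disjoint (A \ B) C then (1 : ZMod 7) else 0))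
  rw [e, sum_add_distrib, ← mul_sum, fano_sum_subset A B hA hB, fano_sum_disjoint A B hA hB]
  have h0 : (0 : ZMod 7) + 3 * 0 = 0 := by decide
  have h1 : (1 : ZMod 7) + 3 * 2 = 0 := by decide
  split_ifs
  · exact h0
  · exact h1

/-- **2-chain periodicity (P2) fails over `ZMod 7` for the Fano plane.**  In the notation of
`OrderedDifferences.linearIndependent_pencil_of_twoChain`: the constant functions `λ = 1`, `μ = 4`, `ν = 2` on the seven lines
satisfy `∑_A λ_A [E ⊆ A] = ∑_A μ_A [E ∩ A = ∅]` and `∑_A μ_A [E ⊆ A] = ∑_A ν_A [E ∩ A = ∅]` for every `E ∈ 𝒜 \\ 𝒜`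
(`1·1 = 4·2` and `4·1 = 2·2` in `ZMod 7` on pairs, `0 = 0` on `∅`), but `λ ≠ ν`.  So the hypothesis `hP2` of that theorem is
not satisfied by every family over every field (CONJECTURE P2 of gens 21–23 is false in characteristic `7`). -/
theorem fano_not_twoChain :
    ¬ (∀ l m n : ↥({{0, 1, 2}, {0, 3, 4}, {0, 5, 6}, {1, 3, 5}, {1, 4, 6}, {2, 3, 6}, {2, 4, 5}} : Finset (Finset (Fin 7))) →
        ZMod 7,
      (∀ E ∈ ({{0, 1, 2}, {0, 3, 4}, {0, 5, 6}, {1, 3, 5}, {1, 4, 6}, {2, 3, 6}, {2, 4, 5}} : Finset (Finset (Fin 7))) \\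
          ({{0, 1, 2}, {0, 3, 4}, {0, 5, 6}, {1, 3, 5}, {1, 4, 6}, {2, 3, 6}, {2, 4, 5}} : Finset (Finset (Fin 7))),
        ∑ A : ({{0, 1, 2}, {0, 3, 4}, {0, 5, 6}, {1, 3, 5}, {1, 4, 6}, {2, 3, 6}, {2, 4, 5}} : Finset (Finset (Fin 7))),
            l A * (if E ⊆ (A : Finset (Fin 7)) then (1 : ZMod 7) else 0) =
          ∑ A : ({{0, 1, 2}, {0, 3, 4}, {0, 5, 6}, {1, 3, 5}, {1, 4, 6}, {2, 3, 6}, {2, 4, 5}} : Finset (Finset (Fin 7))),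
            m A * (if Disjoint E (A : Finset (Fin 7)) then (1 : ZMod 7) else 0)) →
      (∀ E ∈ ({{0, 1, 2}, {0, 3, 4}, {0, 5, 6}, {1, 3, 5}, {1, 4, 6}, {2, 3, 6}, {2, 4, 5}} : Finset (Finset (Fin 7))) \\
          ({{0, 1, 2}, {0, 3, 4}, {0, 5, 6}, {1, 3, 5}, {1, 4, 6}, {2, 3, 6}, {2, 4, 5}} : Finset (Finset (Fin 7))),
        ∑ A : ({{0, 1, 2}, {0, 3, 4}, {0, 5, 6}, {1, 3, 5}, {1, 4, 6}, {2, 3, 6}, {2, 4, 5}} : Finset (Finset (Fin 7))),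
            m A * (if E ⊆ (A : Finset (Fin 7)) then (1 : ZMod 7) else 0) =
          ∑ A : ({{0, 1, 2}, {0, 3, 4}, {0, 5, 6}, {1, 3, 5}, {1, 4, 6}, {2, 3, 6}, {2, 4, 5}} : Finset (Finset (Fin 7))),
            n A * (if Disjoint E (A : Finset (Fin 7)) then (1 : ZMod 7) else 0)) →
      l = n) := by
  intro h
  have key : ∀ (a b : ZMod 7) (E : Finset (Fin 7)),
      E ∈ ({{0, 1, 2}, {0, 3, 4}, {0, 5, 6}, {1, 3, 5}, {1, 4, 6}, {2, 3, 6}, {2, 4, 5}} : Finset (Finset (Fin 7))) \\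
          ({{0, 1, 2}, {0, 3, 4}, {0, 5, 6}, {1, 3, 5}, {1, 4, 6}, {2, 3, 6}, {2, 4, 5}} : Finset (Finset (Fin 7))) →
      a = 2 * b →
      ∑ A : ({{0, 1, 2}, {0, 3, 4}, {0, 5, 6}, {1, 3, 5}, {1, 4, 6}, {2, 3, 6}, {2, 4, 5}} : Finset (Finset (Fin 7))),
          a * (if E ⊆ (A : Finset (Fin 7)) then (1 : ZMod 7) else 0) =
        ∑ A : ({{0, 1, 2}, {0, 3, 4}, {0, 5, 6}, {1, 3, 5}, {1, 4, 6}, {2, 3, 6}, {2, 4, 5}} : Finset (Finset (Fin 7))),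
          b * (if Disjoint E (A : Finset (Fin 7)) then (1 : ZMod 7) else 0) := by
    intro a b E hE hab
    obtain ⟨A, hA, B, hB, rfl⟩ := mem_diffs.mp hE
    have e1 : (∑ C : ({{0, 1, 2}, {0, 3, 4}, {0, 5, 6}, {1, 3, 5}, {1, 4, 6}, {2, 3, 6}, {2, 4, 5}} :
        Finset (Finset (Fin 7))), a * (if A \ B ⊆ (C : Finset (Fin 7)) then (1 : ZMod 7) else 0)) =
        ∑ C ∈ ({{0, 1, 2}, {0, 3, 4}, {0, 5, 6}, {1, 3, 5}, {1, 4, 6}, {2, 3, 6}, {2, 4, 5}} : Finset (Finset (Fin 7))),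
          a * (if A \ B ⊆ C then (1 : ZMod 7) else 0) :=
      Finset.sum_coe_sort _ (fun C => a * (if A \ B ⊆ C then (1 : ZMod 7) else 0))
    have e2 : (∑ C : ({{0, 1, 2}, {0, 3, 4}, {0, 5, 6}, {1, 3, 5}, {1, 4, 6}, {2, 3, 6}, {2, 4, 5}} :
        Finset (Finset (Fin 7))), b * (if Disjoint (A \ B) (C : Finset (Fin 7)) then (1 : ZMod 7) else 0)) =
        ∑ C ∈ ({{0, 1, 2}, {0, 3, 4}, {0, 5, 6}, {1, 3, 5}, {1, 4, 6}, {2, 3, 6}, {2, 4, 5}} : Finset (Finset (Fin 7))),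
          b * (if Disjoint (A \ B) C then (1 : ZMod 7) else 0) :=
      Finset.sum_coe_sort _ (fun C => b * (if Disjoint (A \ B) C then (1 : ZMod 7) else 0))
    rw [e1, e2, ← mul_sum, ← mul_sum, fano_sum_subset A B hA hB, fano_sum_disjoint A B hA hB, hab]
    split_ifs <;> ring
  have hln := h (fun _ => 1) (fun _ => 4) (fun _ => 2)
    (fun E hE => key 1 4 E hE (by decide)) (fun E hE => key 4 2 E hE (by decide))
  have h12 := congr_fun hln ⟨{0, 1, 2}, by simp⟩
  exact absurd h12 (by decide)

/-- **CONJECTURE MS-PENCIL/𝔽 is false.**  There are a finite family of finite sets (the Fano plane on `Fin 7`) and an element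
`t` of a field (`3 ∈ ZMod 7`) with `t * t ≠ 1` whose pencil rows `A ↦ (E ↦ [E ⊆ A] + t [E ∩ A = ∅])` over `𝒜 \\ 𝒜` are
linearly dependent. -/
theorem exists_pencil_rows_dependent :
    ∃ (𝒜 : Finset (Finset (Fin 7))) (t : ZMod 7), t * t ≠ 1 ∧
      ¬ LinearIndependent (ZMod 7) (fun A : 𝒜 => fun E : (𝒜 \\ 𝒜 : Finset (Finset (Fin 7))) =>
        (if (E : Finset (Fin 7)) ⊆ (A : Finset (Fin 7)) then (1 : ZMod 7) else 0) +
          t * (if Disjoint (E : Finset (Fin 7)) (A : Finset (Fin 7)) then (1 : ZMod 7) else 0)) :=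
  ⟨_, 3, by decide, fano_not_linearIndependent_pencil⟩

/-- **CONJECTURE P2 (2-chain periodicity over every field) is false.**  There is a finite family of finite sets (the Fano
plane on `Fin 7`) with a 2-chain `λ Z = μ Y`, `μ Z = ν Y` over `ZMod 7` (sums over `𝒜 \\ 𝒜` exactly as in the hypothesis of
`OrderedDifferences.linearIndependent_pencil_of_twoChain`) having `λ ≠ ν`. -/
theorem exists_not_twoChain :
    ∃ 𝒜 : Finset (Finset (Fin 7)), ¬ (∀ l m n : ↥𝒜 → ZMod 7,
      (∀ E ∈ 𝒜 \\ 𝒜, ∑ A : 𝒜, l A * (if E ⊆ (A : Finset (Fin 7)) then (1 : ZMod 7) else 0) =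
        ∑ A : 𝒜, m A * (if Disjoint E (A : Finset (Fin 7)) then (1 : ZMod 7) else 0)) →
      (∀ E ∈ 𝒜 \\ 𝒜, ∑ A : 𝒜, m A * (if E ⊆ (A : Finset (Fin 7)) then (1 : ZMod 7) else 0) =
        ∑ A : 𝒜, n A * (if Disjoint E (A : Finset (Fin 7)) then (1 : ZMod 7) else 0)) → l = n) :=
  ⟨_, fano_not_twoChain⟩

end OrderedDifferences

end Summit.CriticalPhenomena.PercolationContinuityZ3.Theorems
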